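import Summits.QuantumFields.BalabanUV.Beta.GAN24.DressedStepCharge
import Summits.QuantumFields.BalabanUV.Beta.GAN24.WSlotForcingZeroModeW3
import Summits.QuantumFields.BalabanUV.Beta.GAN24.T2RecOfUnitSplit
import Summits.QuantumFields.BalabanUV.Beta.GAN24.T2SlotCovariance
import Summits.QuantumFields.BalabanUV.Beta.GAN24.WSlotFirstDiff
import Summits.QuantumFields.BalabanUV.Beta.MixedJetTablesPlug
import Summits.QuantumFields.BalabanUV.Beta.GAN24.WSlotT2OfPieces

/-!
# `BalabanUV.Beta.GAN24.T2DevCovariance` — binder row G-an2-4 / (CONV-C), W-slot CT-W, route (R-DEV): **(W4)(i) PART A — JOINT `Lc`-COVARIANCE OF THE DEVIATION TOWER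
# `D_j = T̃_j − T_j` AND OF THE OWNER's FORCING `g′_j`** (the `hDcov` ∕ `hgcov` letters of `T2DevForcingZeroMode`, at the comb literals)

NOT IN PRINT; OUR BOOKKEEPING ([folklore] an2's `T2RecAt_translate` ∕ `T2RecOf_translate` ∕ `SpureRecAt_translate` ∕ `M1At_translate`, an1's `mixFFAt_translate`, `shiftK_KInvStep`,
leaf-19's `T2SlotCovariance.unitS₂_translate`, leaf-18's `sub_translate_pi ∕ add_translate_pi`, (F1)'s `unitS₂_T2RecOf_succ_eq_lin4_add` + `step_data_of_letters`, this lineage's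
`DressedStepCharge.lin4_dressed_translate`; G-an2-4 formalisation swarm, leaf prover `b2b-balaban-gan24-formalise-leaf-01`, gen 62; «MINE (W4)» journal l.37955 ∕ l.38062 — the OWNER gan24-p1 g23's (W4)∕(W11),
route (R-DEV) of RULING R-gan24p1-g23-1 l.37889, `T2DeviationTower` INTENT 2 l.37995; name PROVISIONAL).  HONEST FRAMING (cell contract, verbatim): «discharging `BetaPertH` makes Bałaban's
UV stability UNCONDITIONAL — a real constructive-QFT result; it is NOT the continuum limit and NOT the Clay problem.»  HONEST DEPENDENCY (verbatim): «continuum YM on T⁴ ⇐ BetaPertH ∧ nine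
spine estimates (0/9 proved); BetaPertH ⇐ (D1) ∧ (D4) ∧ CAP+tail; G-an2-4 gates asym, D1 and NE2/3/4.»

## Objects (generic `d`; `Lc` a `NeZero`, `1 ≤ Lc`; in-block root `r ∈ box (d+1) Lc`; `T̃_j := unitS₂_j (T2RecAt d Lc ρ cE cVH cΛ cE₂ cB Tc vh₂S (mixFFAt ρ Lc) j)`,
## `T_j := unitS₂_j (T2RecOf d Lc (KInvStep Lc ·) (SpureRecAt ρ …) (M1At ρ cΛ) cE₂ cB Tc vh₂S (mixFFAt ρ Lc) j)` (the OWNER's undressed-kernel comb-slot tower), `D_j := T̃_j − T_j`,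
## `g′_j` the OWNER's forcing literal of `T2DeviationTower.unitS₂_T2RecAt_dev_eq_sum` VERBATIM, `𝒜^E_j := lin4 c₄ (unitK_j (coDressKBmAt ρ Lc (KInvStep Lc j))) Lc`;
## off-diagonal `LocStencil₂` border `vh₂S` with joint covariance `hBt` displayed (an1's `vh₂SAn1_translate` at the literal))
* §1 `unitS₂_T2RecAt_translate`, `unitS₂_T2RecOfK_translate` (both unit towers jointly `Lc`-covariant), **`dev_comb_translate`** (so is `D_j`).
* §2 `succ_comb_dressed`, `succ_comb_undressed` (the two affine steps at the comb letters), `source_comb_dressed_translate`, `source_comb_undressed_translate` (the sources are covariant,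
  as `T_{j+1} − 𝒜_j T_j`), **`gprime_comb_translate`** (so is `g′_j`).
(Z′) is a HYPOTHESIS wherever it appears (an2's Ward identity behind R1 (N3)); asserts NO shape of Bałaban's tables; discharges NOTHING of «T2Shape» ∕ «T2Drift» ∕ (hW, hWall);
NOT «W-slot closed», NEVER «G-an2-4 closed» as (CONV-C); NOT D1, NOT `BetaPertH`, NOT continuum, NOT Clay.  0 cited facts, 0 `def`, 0 `def … : Prop`, 0 sorry.
-/

noncomputable section

open Finset
open scoped BigOperators
open Literature.MathematicalPhysics.QuantumFieldTheory
open Literature.MathematicalPhysics.QuantumFieldTheory.Balaban1983to89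
open Literature.MathematicalPhysics.QuantumFieldTheory.Balaban1983to89.Beta
open ExpKernelCalculus (MKer Decays BiLoc VertexFamily VertexFamily₂ shiftK)
open OneStepResolventKernel (Fib LocStencil decays_mono)
open OneStepKernelFamily (KInvStep decays_KInvStep shiftK_KInvStep)
open AffineAveraging (box toSite)
open AveragingMixedJetTables (mixFFAt mixFFAt_translate)
open SecondOrderResponse (W2SymOfK LocStencilFM)
open BalabanCompositeJets (LocStencil₂)
open BalabanStepJetsSucc (mmRead)
open BalabanStepW2 (K3OfK M2Of)
open Summit.QuantumFields.BalabanUV.Beta.HessKerDressedUnits (unitK unitS decays_unitK)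
open Summit.QuantumFields.BalabanUV.Beta.SecondOrderUnits (unitM unitS₂ unitM₂)
open Summit.QuantumFields.BalabanUV.Beta.AxialDressingRooted (coDressKBmAt decays_coDressKBmAt_KInvStep)
open Summit.QuantumFields.BalabanUV.Beta.SpineRooted (T2RecOf T2RecAt SpureRecAt M1At T2RecOf_comb T2RecOf_loc T2RecOf_translate T2RecAt_translate T2RecAt_loc_of_slot
  T2RecOf_zero_level T2RecAt_zero_level locStencil_SpureRecAt vertexFamily_M1At SpureRecAt_translate M1At_translate)
open Summit.QuantumFields.BalabanUV.Beta.MixedJetTablesPlug (hmix_an1)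
open Summit.QuantumFields.BalabanUV.Beta.GAN24.CombesThomas (sfStep smStep)
open Summit.QuantumFields.BalabanUV.Beta.GAN24.T2RecursionAffine (lin4)
open Summit.QuantumFields.BalabanUV.Beta.GAN24.BiStencilZeroMode (Tab zmode)
open Summit.QuantumFields.BalabanUV.Beta.GAN24.T2SlotCovariance (unitS₂_translate)
open Summit.QuantumFields.BalabanUV.Beta.GAN24.WSlotFirstDiff (locStencil₂_unitS₂)
open Summit.QuantumFields.BalabanUV.Beta.GAN24.WSlotForcingZeroMode (locStencil₂_sub)
open Summit.QuantumFields.BalabanUV.Beta.GAN24.WSlotT2OfPieces (locStencil₂_add)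
open Summit.QuantumFields.BalabanUV.Beta.GAN24.WSlotForcingZeroModeW3 (add_translate_pi sub_translate_pi)
open Summit.QuantumFields.BalabanUV.Beta.GAN24.Lin4ZeroMode (lin4_translate shiftK_unitKInvStep locStencil₂_lin4)
open Summit.QuantumFields.BalabanUV.Beta.GAN24.T2RecOfUnitSplit (unitS₂_T2RecOf_succ_eq_lin4_add step_data_of_letters)
open Summit.QuantumFields.BalabanUV.Beta.GAN24.DressedStepCharge (lin4_dressed_translate)

namespace Summit.QuantumFields.BalabanUV.Beta.GAN24.T2DevCovariance

variable {d : ℕ} {Lc : ℕ} [NeZero Lc] {r : Fin (d + 1) → ℕ}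

/-! ## §1 Joint `Lc`-covariance of the two unit towers and of the deviation -/

/-- [folklore] **THE NORMALISED COMB TOWER IS JOINTLY `Lc`-COVARIANT** (an2's `T2RecAt_translate` — border covariance `hBt` displayed, an1's `mixFFAt_translate` — through leaf-19's
`unitS₂_translate`). -/
theorem unitS₂_T2RecAt_translate (hLc : 1 ≤ Lc) (cE cVH cΛ cE₂ cB : ℝ) (Tc : Fin 4 → Fin 4 → Fin 4 → Fin 4 → ℝ) {vh₂S : Tab d}
    (hBt : ∀ (κ : Fin (d + 1)) (u : Fin (d + 1) → ℤ) (κ' : Fin (d + 1)) (u' t : Fin (d + 1) → ℤ),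
      vh₂S κ (u + (Lc : ℤ) • t) κ' (u' + (Lc : ℤ) • t) = shiftK (-((Lc : ℤ) • t)) (vh₂S κ u κ' u'))
    (j : ℕ) (κ : Fin (d + 1)) (u : Fin (d + 1) → ℤ) (κ' : Fin (d + 1)) (u' t : Fin (d + 1) → ℤ) :
    (unitS₂ (sfStep Lc j) (smStep d Lc j) (T2RecAt d Lc (toSite r) cE cVH cΛ cE₂ cB Tc vh₂S (mixFFAt (toSite r) Lc) j)) κ (u + (Lc : ℤ) • t) κ' (u' + (Lc : ℤ) • t)
      = shiftK (-((Lc : ℤ) • t)) ((unitS₂ (sfStep Lc j) (smStep d Lc j) (T2RecAt d Lc (toSite r) cE cVH cΛ cE₂ cB Tc vh₂S (mixFFAt (toSite r) Lc) j)) κ u κ' u') :=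
  unitS₂_translate (w := (Lc : ℤ) • t) (v := -((Lc : ℤ) • t)) (sfStep Lc j) (smStep d Lc j)
    (fun κ u κ' u' => T2RecAt_translate (ρ := toSite r) (cE := cE) (cVH := cVH) (cΛ := cΛ) (cE₂ := cE₂) (cB := cB) (T := Tc) (vh₂S := vh₂S)
      (mixFF := mixFFAt (toSite r) Lc) hLc hBt
      (fun κ u μ w t => mixFFAt_translate (toSite r) Lc κ u μ w t) j κ u κ' u' t) κ u κ' u'

/-- [folklore] **THE UNDRESSED-KERNEL COMB-SLOT TOWER IS JOINTLY `Lc`-COVARIANT** (an2's `T2RecOf_translate` with `shiftK_KInvStep`, `SpureRecAt_translate`, `M1At_translate`,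
`mixFFAt_translate`; border `hBt` displayed). -/
theorem unitS₂_T2RecOfK_translate (hLc : 1 ≤ Lc) (cE cVH cΛ cE₂ cB : ℝ) (Tc : Fin 4 → Fin 4 → Fin 4 → Fin 4 → ℝ) {vh₂S : Tab d}
    (hBt : ∀ (κ : Fin (d + 1)) (u : Fin (d + 1) → ℤ) (κ' : Fin (d + 1)) (u' t : Fin (d + 1) → ℤ),
      vh₂S κ (u + (Lc : ℤ) • t) κ' (u' + (Lc : ℤ) • t) = shiftK (-((Lc : ℤ) • t)) (vh₂S κ u κ' u'))
    (j : ℕ) (κ : Fin (d + 1)) (u : Fin (d + 1) → ℤ) (κ' : Fin (d + 1)) (u' t : Fin (d + 1) → ℤ) :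
    (unitS₂ (sfStep Lc j) (smStep d Lc j) (T2RecOf d Lc (fun j => KInvStep (d := d) Lc j) (SpureRecAt d Lc (toSite r) cE cVH cΛ) (M1At d Lc (toSite r) cΛ) cE₂ cB Tc vh₂S (mixFFAt (toSite r) Lc) j)) κ (u + (Lc : ℤ) • t) κ' (u' + (Lc : ℤ) • t)
      = shiftK (-((Lc : ℤ) • t)) ((unitS₂ (sfStep Lc j) (smStep d Lc j) (T2RecOf d Lc (fun j => KInvStep (d := d) Lc j) (SpureRecAt d Lc (toSite r) cE cVH cΛ) (M1At d Lc (toSite r) cΛ) cE₂ cB Tc vh₂S (mixFFAt (toSite r) Lc) j)) κ u κ' u') :=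
  unitS₂_translate (w := (Lc : ℤ) • t) (v := -((Lc : ℤ) • t)) (sfStep Lc j) (smStep d Lc j)
    (fun κ u κ' u' => T2RecOf_translate (G := fun j => KInvStep (d := d) Lc j) (S := SpureRecAt d Lc (toSite r) cE cVH cΛ) (M := M1At d Lc (toSite r) cΛ)
      (cE₂ := cE₂) (cB := cB) (T := Tc) (vh₂S := vh₂S) (mixFF := mixFFAt (toSite r) Lc)
      (fun j t => shiftK_KInvStep (d := d) (Lc := Lc) j t) (fun j κ u t => SpureRecAt_translate (toSite r) hLc cE cVH cΛ j κ u t)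
      (fun j μ w t => M1At_translate (toSite r) cΛ j μ w t) hBt (fun κ u μ w t => mixFFAt_translate (toSite r) Lc κ u μ w t) j κ u κ' u' t) κ u κ' u'

/-- [folklore] **THE DEVIATION `D_j = T̃_j − T_j` IS JOINTLY `Lc`-COVARIANT** (leaf-18's `sub_translate_pi`). -/
theorem dev_comb_translate (hLc : 1 ≤ Lc) (cE cVH cΛ cE₂ cB : ℝ) (Tc : Fin 4 → Fin 4 → Fin 4 → Fin 4 → ℝ) {vh₂S : Tab d}
    (hBt : ∀ (κ : Fin (d + 1)) (u : Fin (d + 1) → ℤ) (κ' : Fin (d + 1)) (u' t : Fin (d + 1) → ℤ),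
      vh₂S κ (u + (Lc : ℤ) • t) κ' (u' + (Lc : ℤ) • t) = shiftK (-((Lc : ℤ) • t)) (vh₂S κ u κ' u'))
    (j : ℕ) (κ : Fin (d + 1)) (u : Fin (d + 1) → ℤ) (κ' : Fin (d + 1)) (u' t : Fin (d + 1) → ℤ) :
    (fun j => (unitS₂ (sfStep Lc j) (smStep d Lc j) (T2RecAt d Lc (toSite r) cE cVH cΛ cE₂ cB Tc vh₂S (mixFFAt (toSite r) Lc) j))
      - (unitS₂ (sfStep Lc j) (smStep d Lc j) (T2RecOf d Lc (fun j => KInvStep (d := d) Lc j) (SpureRecAt d Lc (toSite r) cE cVH cΛ) (M1At d Lc (toSite r) cΛ) cE₂ cB Tc vh₂S (mixFFAt (toSite r) Lc) j))) j κ (u + (Lc : ℤ) • t) κ' (u' + (Lc : ℤ) • t)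
      = shiftK (-((Lc : ℤ) • t)) ((fun j => (unitS₂ (sfStep Lc j) (smStep d Lc j) (T2RecAt d Lc (toSite r) cE cVH cΛ cE₂ cB Tc vh₂S (mixFFAt (toSite r) Lc) j))
      - (unitS₂ (sfStep Lc j) (smStep d Lc j) (T2RecOf d Lc (fun j => KInvStep (d := d) Lc j) (SpureRecAt d Lc (toSite r) cE cVH cΛ) (M1At d Lc (toSite r) cΛ) cE₂ cB Tc vh₂S (mixFFAt (toSite r) Lc) j))) j κ u κ' u') :=
  sub_translate_pi (w := (Lc : ℤ) • t) (v := -((Lc : ℤ) • t))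
    (fun κ u κ' u' => unitS₂_T2RecAt_translate hLc cE cVH cΛ cE₂ cB Tc hBt j κ u κ' u' t)
    (fun κ u κ' u' => unitS₂_T2RecOfK_translate hLc cE cVH cΛ cE₂ cB Tc hBt j κ u κ' u' t) κ u κ' u'

/-! ## §2 The two affine steps at the comb letters; covariance of the sources and of `g′_j` -/

/-- [folklore] **THE DRESSED COMB STEP**: `T̃_{j+1} = 𝒜^E_j T̃_j + b̃_j` ((F1)'s `unitS₂_T2RecOf_succ_eq_lin4_add` with `step_data_of_letters` at the comb letters, through `T2RecOf_comb`). -/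
theorem succ_comb_dressed (hLc : 1 ≤ Lc) (hr : r ∈ box (d + 1) Lc) (cE cVH cΛ cE₂ cB : ℝ) (Tc : Fin 4 → Fin 4 → Fin 4 → Fin 4 → ℝ)
    {vh₂S : Tab d}
    (hBff : ∀ κ u κ' u' x z (α β : Fin (d + 1)), vh₂S κ u κ' u' x z (Sum.inl α) (Sum.inl β) = 0)
    (hBmm : ∀ κ u κ' u' x z (μ ν : Fin (d + 1)), vh₂S κ u κ' u' x z (Sum.inr μ) (Sum.inr ν) = 0)
    (hB : ∃ C δ : ℝ, 0 < δ ∧ LocStencil₂ vh₂S C δ) (j : ℕ) :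
    (unitS₂ (sfStep Lc (j + 1)) (smStep d Lc (j + 1)) (T2RecAt d Lc (toSite r) cE cVH cΛ cE₂ cB Tc vh₂S (mixFFAt (toSite r) Lc) (j + 1))) =
      lin4 (cE₂ * (Lc : ℝ) ^ (2 * (d + 1))) (unitK (sfStep Lc j) (smStep d Lc j) (coDressKBmAt (toSite r) Lc (KInvStep (d := d) Lc j))) Lc
        (unitS₂ (sfStep Lc j) (smStep d Lc j) (T2RecAt d Lc (toSite r) cE cVH cΛ cE₂ cB Tc vh₂S (mixFFAt (toSite r) Lc) j)) +
      (fun κ u κ' u' => (cE₂ * (Lc : ℝ) ^ (2 * (d + 1))) • mmRead Lc (K3OfK (unitK (sfStep Lc j) (smStep d Lc j) (coDressKBmAt (toSite r) Lc (KInvStep (d := d) Lc j))) Lc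
            (unitS (sfStep Lc j) (smStep d Lc j) (SpureRecAt d Lc (toSite r) cE cVH cΛ j)) (unitM (sfStep Lc j) (smStep d Lc j) (M1At d Lc (toSite r) cΛ j))
            (W2SymOfK (unitK (sfStep Lc j) (smStep d Lc j) (coDressKBmAt (toSite r) Lc (KInvStep (d := d) Lc j))) Lc (unitS (sfStep Lc j) (smStep d Lc j) (SpureRecAt d Lc (toSite r) cE cVH cΛ j))
              (unitM (sfStep Lc j) (smStep d Lc j) (M1At d Lc (toSite r) cΛ j)) 0 (unitM₂ (sfStep Lc j) (smStep d Lc j) (M2Of d Lc (mixFFAt (toSite r) Lc) j))) κ u κ' u')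
          + cB • vh₂S κ u κ' u') := by
  obtain ⟨C, δ, C₀, C₁, hδ, hKj, h₀, hW⟩ := step_data_of_letters (fun j => coDressKBmAt (toSite r) Lc (KInvStep (d := d) Lc j))
    (SpureRecAt d Lc (toSite r) cE cVH cΛ) (M1At d Lc (toSite r) cΛ) cE₂ cB Tc (vh₂S := vh₂S) (mixFF := mixFFAt (toSite r) Lc) hLc (fun j => decays_coDressKBmAt_KInvStep (d := d) hr j) (fun j => locStencil_SpureRecAt hLc hr cE cVH cΛ j)
    (fun j => ⟨_, 1, one_pos, vertexFamily_M1At hLc hr cΛ j zero_le_one⟩) hB (hmix_an1 hLc hr) j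
  have h := unitS₂_T2RecOf_succ_eq_lin4_add (fun j => coDressKBmAt (toSite r) Lc (KInvStep (d := d) Lc j))
    (SpureRecAt d Lc (toSite r) cE cVH cΛ) (M1At d Lc (toSite r) cΛ) cE₂ cB Tc vh₂S (mixFFAt (toSite r) Lc) hBff hBmm j hδ hKj h₀ hW
  simp only [T2RecOf_comb] at h
  exact h

/-- [folklore] **THE UNDRESSED-KERNEL COMB-SLOT STEP**: `T_{j+1} = 𝒜^B_j T_j + b_j`. -/
theorem succ_comb_undressed (hLc : 1 ≤ Lc) (hr : r ∈ box (d + 1) Lc) (cE cVH cΛ cE₂ cB : ℝ) (Tc : Fin 4 → Fin 4 → Fin 4 → Fin 4 → ℝ)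
    {vh₂S : Tab d}
    (hBff : ∀ κ u κ' u' x z (α β : Fin (d + 1)), vh₂S κ u κ' u' x z (Sum.inl α) (Sum.inl β) = 0)
    (hBmm : ∀ κ u κ' u' x z (μ ν : Fin (d + 1)), vh₂S κ u κ' u' x z (Sum.inr μ) (Sum.inr ν) = 0)
    (hB : ∃ C δ : ℝ, 0 < δ ∧ LocStencil₂ vh₂S C δ) (j : ℕ) :
    (unitS₂ (sfStep Lc (j + 1)) (smStep d Lc (j + 1)) (T2RecOf d Lc (fun j => KInvStep (d := d) Lc j) (SpureRecAt d Lc (toSite r) cE cVH cΛ) (M1At d Lc (toSite r) cΛ) cE₂ cB Tc vh₂S (mixFFAt (toSite r) Lc) (j + 1))) =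
      lin4 (cE₂ * (Lc : ℝ) ^ (2 * (d + 1))) (unitK (sfStep Lc j) (smStep d Lc j) (KInvStep (d := d) Lc j)) Lc
        (unitS₂ (sfStep Lc j) (smStep d Lc j) (T2RecOf d Lc (fun j => KInvStep (d := d) Lc j) (SpureRecAt d Lc (toSite r) cE cVH cΛ) (M1At d Lc (toSite r) cΛ) cE₂ cB Tc vh₂S (mixFFAt (toSite r) Lc) j)) +
      (fun κ u κ' u' => (cE₂ * (Lc : ℝ) ^ (2 * (d + 1))) • mmRead Lc (K3OfK (unitK (sfStep Lc j) (smStep d Lc j) (KInvStep (d := d) Lc j)) Lc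
            (unitS (sfStep Lc j) (smStep d Lc j) (SpureRecAt d Lc (toSite r) cE cVH cΛ j)) (unitM (sfStep Lc j) (smStep d Lc j) (M1At d Lc (toSite r) cΛ j))
            (W2SymOfK (unitK (sfStep Lc j) (smStep d Lc j) (KInvStep (d := d) Lc j)) Lc (unitS (sfStep Lc j) (smStep d Lc j) (SpureRecAt d Lc (toSite r) cE cVH cΛ j))
              (unitM (sfStep Lc j) (smStep d Lc j) (M1At d Lc (toSite r) cΛ j)) 0 (unitM₂ (sfStep Lc j) (smStep d Lc j) (M2Of d Lc (mixFFAt (toSite r) Lc) j))) κ u κ' u')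
          + cB • vh₂S κ u κ' u') := by
  obtain ⟨C, δ, C₀, C₁, hδ, hKj, h₀, hW⟩ := step_data_of_letters (fun j => KInvStep (d := d) Lc j)
    (SpureRecAt d Lc (toSite r) cE cVH cΛ) (M1At d Lc (toSite r) cΛ) cE₂ cB Tc (vh₂S := vh₂S) (mixFF := mixFFAt (toSite r) Lc) hLc (fun j => decays_KInvStep (d := d) (Lc := Lc) j) (fun j => locStencil_SpureRecAt hLc hr cE cVH cΛ j)
    (fun j => ⟨_, 1, one_pos, vertexFamily_M1At hLc hr cΛ j zero_le_one⟩) hB (hmix_an1 hLc hr) j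
  exact unitS₂_T2RecOf_succ_eq_lin4_add (fun j => KInvStep (d := d) Lc j)
    (SpureRecAt d Lc (toSite r) cE cVH cΛ) (M1At d Lc (toSite r) cΛ) cE₂ cB Tc vh₂S (mixFFAt (toSite r) Lc) hBff hBmm j hδ hKj h₀ hW

/-- [folklore] **THE DRESSED SOURCE `b̃_j` IS JOINTLY `Lc`-COVARIANT** (as `T̃_{j+1} − 𝒜^E_j T̃_j`: tower covariance + `DressedStepCharge.lin4_dressed_translate`). -/
theorem source_comb_dressed_translate (hLc : 1 ≤ Lc) (hr : r ∈ box (d + 1) Lc) (cE cVH cΛ cE₂ cB : ℝ) (Tc : Fin 4 → Fin 4 → Fin 4 → Fin 4 → ℝ)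
    {vh₂S : Tab d}
    (hBff : ∀ κ u κ' u' x z (α β : Fin (d + 1)), vh₂S κ u κ' u' x z (Sum.inl α) (Sum.inl β) = 0)
    (hBmm : ∀ κ u κ' u' x z (μ ν : Fin (d + 1)), vh₂S κ u κ' u' x z (Sum.inr μ) (Sum.inr ν) = 0)
    (hB : ∃ C δ : ℝ, 0 < δ ∧ LocStencil₂ vh₂S C δ)
    (hBt : ∀ (κ : Fin (d + 1)) (u : Fin (d + 1) → ℤ) (κ' : Fin (d + 1)) (u' t : Fin (d + 1) → ℤ),
      vh₂S κ (u + (Lc : ℤ) • t) κ' (u' + (Lc : ℤ) • t) = shiftK (-((Lc : ℤ) • t)) (vh₂S κ u κ' u')) (j : ℕ) (κ : Fin (d + 1)) (u : Fin (d + 1) → ℤ) (κ' : Fin (d + 1)) (u' t : Fin (d + 1) → ℤ) :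
    (fun κ u κ' u' => (cE₂ * (Lc : ℝ) ^ (2 * (d + 1))) • mmRead Lc (K3OfK (unitK (sfStep Lc j) (smStep d Lc j) (coDressKBmAt (toSite r) Lc (KInvStep (d := d) Lc j))) Lc
            (unitS (sfStep Lc j) (smStep d Lc j) (SpureRecAt d Lc (toSite r) cE cVH cΛ j)) (unitM (sfStep Lc j) (smStep d Lc j) (M1At d Lc (toSite r) cΛ j))
            (W2SymOfK (unitK (sfStep Lc j) (smStep d Lc j) (coDressKBmAt (toSite r) Lc (KInvStep (d := d) Lc j))) Lc (unitS (sfStep Lc j) (smStep d Lc j) (SpureRecAt d Lc (toSite r) cE cVH cΛ j))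
              (unitM (sfStep Lc j) (smStep d Lc j) (M1At d Lc (toSite r) cΛ j)) 0 (unitM₂ (sfStep Lc j) (smStep d Lc j) (M2Of d Lc (mixFFAt (toSite r) Lc) j))) κ u κ' u')
          + cB • vh₂S κ u κ' u') κ (u + (Lc : ℤ) • t) κ' (u' + (Lc : ℤ) • t)
      = shiftK (-((Lc : ℤ) • t)) ((fun κ u κ' u' => (cE₂ * (Lc : ℝ) ^ (2 * (d + 1))) • mmRead Lc (K3OfK (unitK (sfStep Lc j) (smStep d Lc j) (coDressKBmAt (toSite r) Lc (KInvStep (d := d) Lc j))) Lc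
            (unitS (sfStep Lc j) (smStep d Lc j) (SpureRecAt d Lc (toSite r) cE cVH cΛ j)) (unitM (sfStep Lc j) (smStep d Lc j) (M1At d Lc (toSite r) cΛ j))
            (W2SymOfK (unitK (sfStep Lc j) (smStep d Lc j) (coDressKBmAt (toSite r) Lc (KInvStep (d := d) Lc j))) Lc (unitS (sfStep Lc j) (smStep d Lc j) (SpureRecAt d Lc (toSite r) cE cVH cΛ j))
              (unitM (sfStep Lc j) (smStep d Lc j) (M1At d Lc (toSite r) cΛ j)) 0 (unitM₂ (sfStep Lc j) (smStep d Lc j) (M2Of d Lc (mixFFAt (toSite r) Lc) j))) κ u κ' u')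
          + cB • vh₂S κ u κ' u') κ u κ' u') := by
  have e : (fun κ u κ' u' => (cE₂ * (Lc : ℝ) ^ (2 * (d + 1))) • mmRead Lc (K3OfK (unitK (sfStep Lc j) (smStep d Lc j) (coDressKBmAt (toSite r) Lc (KInvStep (d := d) Lc j))) Lc
            (unitS (sfStep Lc j) (smStep d Lc j) (SpureRecAt d Lc (toSite r) cE cVH cΛ j)) (unitM (sfStep Lc j) (smStep d Lc j) (M1At d Lc (toSite r) cΛ j))
            (W2SymOfK (unitK (sfStep Lc j) (smStep d Lc j) (coDressKBmAt (toSite r) Lc (KInvStep (d := d) Lc j))) Lc (unitS (sfStep Lc j) (smStep d Lc j) (SpureRecAt d Lc (toSite r) cE cVH cΛ j))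
              (unitM (sfStep Lc j) (smStep d Lc j) (M1At d Lc (toSite r) cΛ j)) 0 (unitM₂ (sfStep Lc j) (smStep d Lc j) (M2Of d Lc (mixFFAt (toSite r) Lc) j))) κ u κ' u')
          + cB • vh₂S κ u κ' u') =
      (unitS₂ (sfStep Lc (j + 1)) (smStep d Lc (j + 1)) (T2RecAt d Lc (toSite r) cE cVH cΛ cE₂ cB Tc vh₂S (mixFFAt (toSite r) Lc) (j + 1))) -
      lin4 (cE₂ * (Lc : ℝ) ^ (2 * (d + 1))) (unitK (sfStep Lc j) (smStep d Lc j) (coDressKBmAt (toSite r) Lc (KInvStep (d := d) Lc j))) Lc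
        (unitS₂ (sfStep Lc j) (smStep d Lc j) (T2RecAt d Lc (toSite r) cE cVH cΛ cE₂ cB Tc vh₂S (mixFFAt (toSite r) Lc) j)) := by
    rw [succ_comb_dressed hLc hr cE cVH cΛ cE₂ cB Tc hBff hBmm hB j, add_sub_cancel_left]
  rw [e]
  exact sub_translate_pi (w := (Lc : ℤ) • t) (v := -((Lc : ℤ) • t))
    (fun κ u κ' u' => unitS₂_T2RecAt_translate hLc cE cVH cΛ cE₂ cB Tc hBt (j + 1) κ u κ' u' t)
    (fun κ u κ' u' => lin4_dressed_translate (toSite r) j _ (fun κ u κ' u' t => unitS₂_T2RecAt_translate hLc cE cVH cΛ cE₂ cB Tc hBt j κ u κ' u' t)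
      κ u κ' u' ((Lc : ℤ) • t)) κ u κ' u'

/-- [folklore] **THE UNDRESSED-KERNEL SOURCE `b_j` IS JOINTLY `Lc`-COVARIANT** (as `T_{j+1} − 𝒜^B_j T_j`: tower covariance + `Lin4ZeroMode.lin4_translate` with `shiftK_unitKInvStep`). -/
theorem source_comb_undressed_translate (hLc : 1 ≤ Lc) (hr : r ∈ box (d + 1) Lc) (cE cVH cΛ cE₂ cB : ℝ) (Tc : Fin 4 → Fin 4 → Fin 4 → Fin 4 → ℝ)
    {vh₂S : Tab d}
    (hBff : ∀ κ u κ' u' x z (α β : Fin (d + 1)), vh₂S κ u κ' u' x z (Sum.inl α) (Sum.inl β) = 0)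
    (hBmm : ∀ κ u κ' u' x z (μ ν : Fin (d + 1)), vh₂S κ u κ' u' x z (Sum.inr μ) (Sum.inr ν) = 0)
    (hB : ∃ C δ : ℝ, 0 < δ ∧ LocStencil₂ vh₂S C δ)
    (hBt : ∀ (κ : Fin (d + 1)) (u : Fin (d + 1) → ℤ) (κ' : Fin (d + 1)) (u' t : Fin (d + 1) → ℤ),
      vh₂S κ (u + (Lc : ℤ) • t) κ' (u' + (Lc : ℤ) • t) = shiftK (-((Lc : ℤ) • t)) (vh₂S κ u κ' u')) (j : ℕ) (κ : Fin (d + 1)) (u : Fin (d + 1) → ℤ) (κ' : Fin (d + 1)) (u' t : Fin (d + 1) → ℤ) :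
    (fun κ u κ' u' => (cE₂ * (Lc : ℝ) ^ (2 * (d + 1))) • mmRead Lc (K3OfK (unitK (sfStep Lc j) (smStep d Lc j) (KInvStep (d := d) Lc j)) Lc
            (unitS (sfStep Lc j) (smStep d Lc j) (SpureRecAt d Lc (toSite r) cE cVH cΛ j)) (unitM (sfStep Lc j) (smStep d Lc j) (M1At d Lc (toSite r) cΛ j))
            (W2SymOfK (unitK (sfStep Lc j) (smStep d Lc j) (KInvStep (d := d) Lc j)) Lc (unitS (sfStep Lc j) (smStep d Lc j) (SpureRecAt d Lc (toSite r) cE cVH cΛ j))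
              (unitM (sfStep Lc j) (smStep d Lc j) (M1At d Lc (toSite r) cΛ j)) 0 (unitM₂ (sfStep Lc j) (smStep d Lc j) (M2Of d Lc (mixFFAt (toSite r) Lc) j))) κ u κ' u')
          + cB • vh₂S κ u κ' u') κ (u + (Lc : ℤ) • t) κ' (u' + (Lc : ℤ) • t)
      = shiftK (-((Lc : ℤ) • t)) ((fun κ u κ' u' => (cE₂ * (Lc : ℝ) ^ (2 * (d + 1))) • mmRead Lc (K3OfK (unitK (sfStep Lc j) (smStep d Lc j) (KInvStep (d := d) Lc j)) Lc
            (unitS (sfStep Lc j) (smStep d Lc j) (SpureRecAt d Lc (toSite r) cE cVH cΛ j)) (unitM (sfStep Lc j) (smStep d Lc j) (M1At d Lc (toSite r) cΛ j))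
            (W2SymOfK (unitK (sfStep Lc j) (smStep d Lc j) (KInvStep (d := d) Lc j)) Lc (unitS (sfStep Lc j) (smStep d Lc j) (SpureRecAt d Lc (toSite r) cE cVH cΛ j))
              (unitM (sfStep Lc j) (smStep d Lc j) (M1At d Lc (toSite r) cΛ j)) 0 (unitM₂ (sfStep Lc j) (smStep d Lc j) (M2Of d Lc (mixFFAt (toSite r) Lc) j))) κ u κ' u')
          + cB • vh₂S κ u κ' u') κ u κ' u') := by
  have e : (fun κ u κ' u' => (cE₂ * (Lc : ℝ) ^ (2 * (d + 1))) • mmRead Lc (K3OfK (unitK (sfStep Lc j) (smStep d Lc j) (KInvStep (d := d) Lc j)) Lc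
            (unitS (sfStep Lc j) (smStep d Lc j) (SpureRecAt d Lc (toSite r) cE cVH cΛ j)) (unitM (sfStep Lc j) (smStep d Lc j) (M1At d Lc (toSite r) cΛ j))
            (W2SymOfK (unitK (sfStep Lc j) (smStep d Lc j) (KInvStep (d := d) Lc j)) Lc (unitS (sfStep Lc j) (smStep d Lc j) (SpureRecAt d Lc (toSite r) cE cVH cΛ j))
              (unitM (sfStep Lc j) (smStep d Lc j) (M1At d Lc (toSite r) cΛ j)) 0 (unitM₂ (sfStep Lc j) (smStep d Lc j) (M2Of d Lc (mixFFAt (toSite r) Lc) j))) κ u κ' u')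
          + cB • vh₂S κ u κ' u') =
      (unitS₂ (sfStep Lc (j + 1)) (smStep d Lc (j + 1)) (T2RecOf d Lc (fun j => KInvStep (d := d) Lc j) (SpureRecAt d Lc (toSite r) cE cVH cΛ) (M1At d Lc (toSite r) cΛ) cE₂ cB Tc vh₂S (mixFFAt (toSite r) Lc) (j + 1))) -
      lin4 (cE₂ * (Lc : ℝ) ^ (2 * (d + 1))) (unitK (sfStep Lc j) (smStep d Lc j) (KInvStep (d := d) Lc j)) Lc
        (unitS₂ (sfStep Lc j) (smStep d Lc j) (T2RecOf d Lc (fun j => KInvStep (d := d) Lc j) (SpureRecAt d Lc (toSite r) cE cVH cΛ) (M1At d Lc (toSite r) cΛ) cE₂ cB Tc vh₂S (mixFFAt (toSite r) Lc) j)) := by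
    rw [succ_comb_undressed hLc hr cE cVH cΛ cE₂ cB Tc hBff hBmm hB j, add_sub_cancel_left]
  rw [e]
  exact sub_translate_pi (w := (Lc : ℤ) • t) (v := -((Lc : ℤ) • t))
    (fun κ u κ' u' => unitS₂_T2RecOfK_translate hLc cE cVH cΛ cE₂ cB Tc hBt (j + 1) κ u κ' u' t)
    (fun κ u κ' u' => lin4_translate (shiftK_unitKInvStep j) _ (fun κ u κ' u' t => unitS₂_T2RecOfK_translate hLc cE cVH cΛ cE₂ cB Tc hBt j κ u κ' u' t)
      κ u κ' u' ((Lc : ℤ) • t)) κ u κ' u'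

/-- NOT IN PRINT; OUR BOOKKEEPING.  **THE OWNER's FORCING `g′_j` IS JOINTLY `Lc`-COVARIANT** (`g′_j = (𝒜^E_j T_j − 𝒜^B_j T_j) + (b̃_j − b_j)`, the literal of
`T2DeviationTower.unitS₂_T2RecAt_dev_eq_sum` token for token: the two steps on the covariant undressed tower + the two sources; leaf-18's `add∕sub_translate_pi`). -/
theorem gprime_comb_translate (hLc : 1 ≤ Lc) (hr : r ∈ box (d + 1) Lc) (cE cVH cΛ cE₂ cB : ℝ) (Tc : Fin 4 → Fin 4 → Fin 4 → Fin 4 → ℝ)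
    {vh₂S : Tab d}
    (hBff : ∀ κ u κ' u' x z (α β : Fin (d + 1)), vh₂S κ u κ' u' x z (Sum.inl α) (Sum.inl β) = 0)
    (hBmm : ∀ κ u κ' u' x z (μ ν : Fin (d + 1)), vh₂S κ u κ' u' x z (Sum.inr μ) (Sum.inr ν) = 0)
    (hB : ∃ C δ : ℝ, 0 < δ ∧ LocStencil₂ vh₂S C δ)
    (hBt : ∀ (κ : Fin (d + 1)) (u : Fin (d + 1) → ℤ) (κ' : Fin (d + 1)) (u' t : Fin (d + 1) → ℤ),
      vh₂S κ (u + (Lc : ℤ) • t) κ' (u' + (Lc : ℤ) • t) = shiftK (-((Lc : ℤ) • t)) (vh₂S κ u κ' u')) (i : ℕ) (κ : Fin (d + 1)) (u : Fin (d + 1) → ℤ) (κ' : Fin (d + 1)) (u' t : Fin (d + 1) → ℤ) :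
    (((lin4 (cE₂ * (Lc : ℝ) ^ (2 * (d + 1))) (unitK (sfStep Lc i) (smStep d Lc i) (coDressKBmAt (toSite r) Lc (KInvStep (d := d) Lc i))) Lc
            (unitS₂ (sfStep Lc i) (smStep d Lc i) (T2RecOf d Lc (fun j => KInvStep (d := d) Lc j) (SpureRecAt d Lc (toSite r) cE cVH cΛ) (M1At d Lc (toSite r) cΛ) cE₂ cB Tc vh₂S (mixFFAt (toSite r) Lc) i)) -
          lin4 (cE₂ * (Lc : ℝ) ^ (2 * (d + 1))) (unitK (sfStep Lc i) (smStep d Lc i) (KInvStep (d := d) Lc i)) Lc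
            (unitS₂ (sfStep Lc i) (smStep d Lc i) (T2RecOf d Lc (fun j => KInvStep (d := d) Lc j) (SpureRecAt d Lc (toSite r) cE cVH cΛ) (M1At d Lc (toSite r) cΛ) cE₂ cB Tc vh₂S (mixFFAt (toSite r) Lc) i))) +
        ((fun κ u κ' u' => (cE₂ * (Lc : ℝ) ^ (2 * (d + 1))) • mmRead Lc (K3OfK (unitK (sfStep Lc i) (smStep d Lc i) (coDressKBmAt (toSite r) Lc (KInvStep (d := d) Lc i))) Lc
            (unitS (sfStep Lc i) (smStep d Lc i) (SpureRecAt d Lc (toSite r) cE cVH cΛ i)) (unitM (sfStep Lc i) (smStep d Lc i) (M1At d Lc (toSite r) cΛ i))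
            (W2SymOfK (unitK (sfStep Lc i) (smStep d Lc i) (coDressKBmAt (toSite r) Lc (KInvStep (d := d) Lc i))) Lc (unitS (sfStep Lc i) (smStep d Lc i) (SpureRecAt d Lc (toSite r) cE cVH cΛ i))
              (unitM (sfStep Lc i) (smStep d Lc i) (M1At d Lc (toSite r) cΛ i)) 0 (unitM₂ (sfStep Lc i) (smStep d Lc i) (M2Of d Lc (mixFFAt (toSite r) Lc) i))) κ u κ' u')
          + cB • vh₂S κ u κ' u') -
         (fun κ u κ' u' => (cE₂ * (Lc : ℝ) ^ (2 * (d + 1))) • mmRead Lc (K3OfK (unitK (sfStep Lc i) (smStep d Lc i) (KInvStep (d := d) Lc i)) Lc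
            (unitS (sfStep Lc i) (smStep d Lc i) (SpureRecAt d Lc (toSite r) cE cVH cΛ i)) (unitM (sfStep Lc i) (smStep d Lc i) (M1At d Lc (toSite r) cΛ i))
            (W2SymOfK (unitK (sfStep Lc i) (smStep d Lc i) (KInvStep (d := d) Lc i)) Lc (unitS (sfStep Lc i) (smStep d Lc i) (SpureRecAt d Lc (toSite r) cE cVH cΛ i))
              (unitM (sfStep Lc i) (smStep d Lc i) (M1At d Lc (toSite r) cΛ i)) 0 (unitM₂ (sfStep Lc i) (smStep d Lc i) (M2Of d Lc (mixFFAt (toSite r) Lc) i))) κ u κ' u')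
          + cB • vh₂S κ u κ' u')))) κ (u + (Lc : ℤ) • t) κ' (u' + (Lc : ℤ) • t)
      = shiftK (-((Lc : ℤ) • t)) ((((lin4 (cE₂ * (Lc : ℝ) ^ (2 * (d + 1))) (unitK (sfStep Lc i) (smStep d Lc i) (coDressKBmAt (toSite r) Lc (KInvStep (d := d) Lc i))) Lc
            (unitS₂ (sfStep Lc i) (smStep d Lc i) (T2RecOf d Lc (fun j => KInvStep (d := d) Lc j) (SpureRecAt d Lc (toSite r) cE cVH cΛ) (M1At d Lc (toSite r) cΛ) cE₂ cB Tc vh₂S (mixFFAt (toSite r) Lc) i)) -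
          lin4 (cE₂ * (Lc : ℝ) ^ (2 * (d + 1))) (unitK (sfStep Lc i) (smStep d Lc i) (KInvStep (d := d) Lc i)) Lc
            (unitS₂ (sfStep Lc i) (smStep d Lc i) (T2RecOf d Lc (fun j => KInvStep (d := d) Lc j) (SpureRecAt d Lc (toSite r) cE cVH cΛ) (M1At d Lc (toSite r) cΛ) cE₂ cB Tc vh₂S (mixFFAt (toSite r) Lc) i))) +
        ((fun κ u κ' u' => (cE₂ * (Lc : ℝ) ^ (2 * (d + 1))) • mmRead Lc (K3OfK (unitK (sfStep Lc i) (smStep d Lc i) (coDressKBmAt (toSite r) Lc (KInvStep (d := d) Lc i))) Lc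
            (unitS (sfStep Lc i) (smStep d Lc i) (SpureRecAt d Lc (toSite r) cE cVH cΛ i)) (unitM (sfStep Lc i) (smStep d Lc i) (M1At d Lc (toSite r) cΛ i))
            (W2SymOfK (unitK (sfStep Lc i) (smStep d Lc i) (coDressKBmAt (toSite r) Lc (KInvStep (d := d) Lc i))) Lc (unitS (sfStep Lc i) (smStep d Lc i) (SpureRecAt d Lc (toSite r) cE cVH cΛ i))
              (unitM (sfStep Lc i) (smStep d Lc i) (M1At d Lc (toSite r) cΛ i)) 0 (unitM₂ (sfStep Lc i) (smStep d Lc i) (M2Of d Lc (mixFFAt (toSite r) Lc) i))) κ u κ' u')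
          + cB • vh₂S κ u κ' u') -
         (fun κ u κ' u' => (cE₂ * (Lc : ℝ) ^ (2 * (d + 1))) • mmRead Lc (K3OfK (unitK (sfStep Lc i) (smStep d Lc i) (KInvStep (d := d) Lc i)) Lc
            (unitS (sfStep Lc i) (smStep d Lc i) (SpureRecAt d Lc (toSite r) cE cVH cΛ i)) (unitM (sfStep Lc i) (smStep d Lc i) (M1At d Lc (toSite r) cΛ i))
            (W2SymOfK (unitK (sfStep Lc i) (smStep d Lc i) (KInvStep (d := d) Lc i)) Lc (unitS (sfStep Lc i) (smStep d Lc i) (SpureRecAt d Lc (toSite r) cE cVH cΛ i))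
              (unitM (sfStep Lc i) (smStep d Lc i) (M1At d Lc (toSite r) cΛ i)) 0 (unitM₂ (sfStep Lc i) (smStep d Lc i) (M2Of d Lc (mixFFAt (toSite r) Lc) i))) κ u κ' u')
          + cB • vh₂S κ u κ' u')))) κ u κ' u') :=
  add_translate_pi (w := (Lc : ℤ) • t) (v := -((Lc : ℤ) • t))
    (sub_translate_pi
      (fun κ u κ' u' => lin4_dressed_translate (toSite r) i _ (fun κ u κ' u' t => unitS₂_T2RecOfK_translate hLc cE cVH cΛ cE₂ cB Tc hBt i κ u κ' u' t)
        κ u κ' u' ((Lc : ℤ) • t))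
      (fun κ u κ' u' => lin4_translate (shiftK_unitKInvStep i) _ (fun κ u κ' u' t => unitS₂_T2RecOfK_translate hLc cE cVH cΛ cE₂ cB Tc hBt i κ u κ' u' t)
        κ u κ' u' ((Lc : ℤ) • t)))
    (sub_translate_pi (fun κ u κ' u' => source_comb_dressed_translate hLc hr cE cVH cΛ cE₂ cB Tc hBff hBmm hB hBt i κ u κ' u' t)
      (fun κ u κ' u' => source_comb_undressed_translate hLc hr cE cVH cΛ cE₂ cB Tc hBff hBmm hB hBt i κ u κ' u' t)) κ u κ' u'

end Summit.QuantumFields.BalabanUV.Beta.GAN24.T2DevCovariance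

end
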